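import Summits.AtomisticToContinuum.BoseEinsteinCondensation.Theses.BECRieszReverseHolder
import Literature.MathematicalPhysics.QuantumManyBody.BoseGasThermodynamicLimitRuelle
import Literature.MathematicalPhysics.QuantumManyBody.BoseGasDirichletWall
import Literature.MathematicalPhysics.QuantumManyBody.PeriodicBoseGasThm31
import Literature.MathematicalPhysics.StatisticalMechanics.PeriodicRieszKernelSelfEnergy
import Literature.MathematicalPhysics.StatisticalMechanics.PeriodicRieszKernelFourier
import HarnessLib

/-!
# Extraction of the Bose corner from the variance engine (route BECRieszReverseHolder)

Line `registered` of crux stmt-AtomisticToContinuum-12840 `CoarseGrainedReverseHolder`; registered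
sub-goal `stub_bosecornerOfStructureFactor` (S4′b): pure real-analysis bookkeeping taking the
`L`-uniform smooth structure-factor bound of the smeared periodic Riesz-2 gas (conclusion of S4′C,
here a HYPOTHESIS)

  `∫_{[0,L)^{3n}} D_{t₀} e^{-bH} ≤ [n g(0) / (2 K₂ (√t₀ − η))] ∫_{[0,L)^{3n}} e^{-bH}`
  (`0 < L`, `0 ≤ b`, `0 < η`, `η² < t₀`; `g = periodicRieszKernel 2 L η`,
  `D_t(X) = Σ_{i,j} Θ_{L,t}(X_i − X_j)`, `Θ_{L,t} = periodicHeatSum L t`, `K₂ = rieszSubordinationConst 2`)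

to the Bose dictionary `L = sideLength ρ (n+1)` (`L³ = (n+1)/ρ`), `a = (scatteringLength v).toReal ≥ 0`,
`b = 2π^{-3/2}(a/ρ)^{1/2} ≥ 0`, `η = max((8πρa)^{-1/2}, ρ^{-1/3}) ≥ ρ^{-1/3} > 0`: the normalised
smooth structure factor `W_n = (L³/n²) · ∫ D_{t₀} e^{-bH} / ∫ e^{-bH}` at `t₀ = ℓ² + 4η²` satisfies
`W_n ≤ C₂ / K₂` for every `n ≥ 1`, where `C₂` is the uniform self-energy constant
`0 ≤ g(0) ≤ C₂ η⁻²` of `exists_periodicRieszKernel_zero_le`.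

Proof. `√t₀ ≥ 2η`, so `√t₀ − η ≥ η > 0` and `η² < t₀`; the engine and `∫ e^{-bH} ≥ 0` give
`∫ D e^{-bH} / ∫ e^{-bH} ≤ n g(0) / (2K₂(√t₀ − η)) ≤ n g(0) / (2 K₂ η)` (a vanishing denominator makes
the quotient `0`); with `g(0) ≤ C₂ η⁻²`, `L³ = (n+1)/ρ` and `ρ η³ ≥ 1`:
`W_n ≤ C₂ (n+1) / (2 K₂ n ρ η³) ≤ C₂ (n+1) / (2 K₂ n) ≤ C₂ / K₂`.
-/

noncomputable section

open MeasureTheory Filter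

namespace Summit.AtomisticToContinuum.BoseEinsteinCondensation.Theorems.CoarseGrainedReverseHolder

open Literature.MathematicalPhysics.QuantumManyBody Literature.MathematicalPhysics.StatisticalMechanics
open BoseGas

namespace BoseCornerStructureFactor

/-- **Kac corner of the Bose dictionary**: the smearing length `η = max((8πρa)^{-1/2}, ρ^{-1/3})`
satisfies `ρ η³ ≥ 1`. -/
theorem one_le_mul_pow_three {ρ a η : ℝ} (hρ : 0 < ρ)
    (hη : η = max ((8 * Real.pi * ρ * a) ^ (-(1 / 2 : ℝ))) (ρ ^ (-(1 / 3 : ℝ)))) :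
    1 ≤ ρ * η ^ 3 := by
  have hρ13 : 0 < ρ ^ (-(1 / 3 : ℝ)) := Real.rpow_pos_of_pos hρ _
  have hρη : ρ ^ (-(1 / 3 : ℝ)) ≤ η := hη ▸ le_max_right _ _
  have h1 : (ρ ^ (-(1 / 3 : ℝ))) ^ 3 = ρ⁻¹ := by
    rw [← Real.rpow_natCast, ← Real.rpow_mul hρ.le, ← Real.rpow_neg_one]
    norm_num
  have h2 : (ρ ^ (-(1 / 3 : ℝ))) ^ 3 ≤ η ^ 3 := pow_le_pow_left₀ hρ13.le hρη 3
  rw [h1] at h2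
  calc (1 : ℝ) = ρ * ρ⁻¹ := (mul_inv_cancel₀ hρ.ne').symm
    _ ≤ ρ * η ^ 3 := mul_le_mul_of_nonneg_left h2 hρ.le

/-- **The smearing length of the Bose dictionary is positive**: `η ≥ ρ^{-1/3} > 0`. -/
theorem eta_pos {ρ a η : ℝ} (hρ : 0 < ρ)
    (hη : η = max ((8 * Real.pi * ρ * a) ^ (-(1 / 2 : ℝ))) (ρ ^ (-(1 / 3 : ℝ)))) : 0 < η :=
  (Real.rpow_pos_of_pos hρ _).trans_le (hη ▸ le_max_right _ _)

/-- **The corner arithmetic**: for `n ≥ 1`, `K, C₂, ρ, η > 0`, `ρ η³ ≥ 1` and `g₀ ≤ C₂ η⁻²`,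
`((n+1)/ρ) / n² · (n g₀ / (2 K η)) ≤ C₂ / K`. -/
theorem corner_arith {n K C₂ ρ η g₀ : ℝ} (hn : 1 ≤ n) (hK : 0 < K) (hC₂ : 0 < C₂) (hρ : 0 < ρ)
    (hη : 0 < η) (hρη : 1 ≤ ρ * η ^ 3) (hg₀le : g₀ ≤ C₂ * (η ^ 2)⁻¹) :
    (n + 1) / ρ / n ^ 2 * (n * g₀ / (2 * K * η)) ≤ C₂ / K := by
  have hn0 : 0 < n := by linarith
  have hρ0 : ρ ≠ 0 := hρ.ne'
  have hη0 : η ≠ 0 := hη.ne'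
  have hK0 : K ≠ 0 := hK.ne'
  have hn0' : n ≠ 0 := hn0.ne'
  calc (n + 1) / ρ / n ^ 2 * (n * g₀ / (2 * K * η))
      ≤ (n + 1) / ρ / n ^ 2 * (n * (C₂ * (η ^ 2)⁻¹) / (2 * K * η)) := by gcongr
    _ = C₂ * (n + 1) / (2 * K * n * (ρ * η ^ 3)) := by field_simp
    _ ≤ C₂ * (n + 1) / (2 * K * n * 1) :=
        div_le_div_of_nonneg_left (by positivity) (by positivity)
          (mul_le_mul_of_nonneg_left hρη (by positivity))
    _ ≤ C₂ * (2 * n) / (2 * K * n * 1) := by gcongr; linarith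
    _ = C₂ / K := by field_simp

end BoseCornerStructureFactor

/-- **S4′b — extraction of the Bose corner from the variance engine.** From the structure-factor
bound `∫ D_{t₀} e^{-bH} ≤ [n g(0)/(2K₂(√t₀ − η))] ∫ e^{-bH}` (conclusion of S4′C, hypothesis here):
for admissible `v`, every `0 < ρ < 1` (any positive threshold works) and every `ℓ > 0`, eventually
in `n` along the Bose dictionary (`L = sideLength ρ (n+1)`, `a = (scatteringLength v).toReal`,
`b = 2π^{-3/2}(a/ρ)^{1/2}`, `η = max((8πρa)^{-1/2}, ρ^{-1/3})`), the normalised smooth structure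
factor `W_n = (L³/n²) ∫ D_{ℓ²+4η²} e^{-bH} / ∫ e^{-bH}` is at most `C₂ / K₂` (`C₂` the uniform
self-energy constant of `exists_periodicRieszKernel_zero_le`, `K₂ = rieszSubordinationConst 2`):
`√t₀ − η ≥ η`, `g(0) ≤ C₂ η⁻²`, `L³ = (n+1)/ρ`, `ρη³ ≥ 1`, `n + 1 ≤ 2n`. -/
theorem stub_bosecornerOfStructureFactor : (∀ (n : ℕ) (L b η t₀ : ℝ), 0 < L → 0 ≤ b → 0 < η → η ^ 2 < t₀ → ∀ H : BoseGas.Config n → ℝ, H = (fun X => ∑ i : Fin n, ∑ j : Fin n with i < j, periodicRieszKernel 2 L η (X i - X j)) → ∫ X in BoseGas.cellN n L, (∑ i : Fin n, ∑ j : Fin n, periodicHeatSum L t₀ (X i - X j)) * Real.exp (-(b * H X)) ≤ (n : ℝ) * periodicRieszKernel 2 L η 0 / (2 * rieszSubordinationConst 2 * (Real.sqrt t₀ - η)) * ∫ X in BoseGas.cellN n L, Real.exp (-(b * H X))) → ∀ v : ℝ → ENNReal, BoseGas.IsRepulsiveFiniteRange v → ∃ ρ₀ : ℝ, 0 < ρ₀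 ∧ ∀ ρ : ℝ, 0 < ρ → ρ < ρ₀ → ∀ ℓ : ℝ, 0 < ℓ → ∃ C : ℝ, ∀ᶠ n : ℕ in Filter.atTop, ∀ (L : ℝ), L = BoseGas.sideLength ρ (n + 1) → ∀ (a : ℝ), a = (BoseGas.scatteringLength v).toReal → ∀ (b : ℝ), b = 2 * Real.pi ^ (-(3 / 2 : ℝ)) * (a / ρ) ^ (1 / 2 : ℝ) → ∀ (η : ℝ), η = max ((8 * Real.pi * ρ * a) ^ (-(1 / 2 : ℝ))) (ρ ^ (-(1 / 3 : ℝ))) → ∀ (H : BoseGas.Config n → ℝ), H = (fun X => ∑ i : Fin n, ∑ j : Fin n with i < j, periodicRieszKernel 2 L η (X i - X j)) → L ^ 3 / (n : ℝ) ^ 2 * ((∫ X in BoseGas.cellN n L, (∑ i : Fin n, ∑ j : Fin n, periodicHeatSum L (ℓ ^ 2 + 4 * η ^ 2) (X i - X j)) * Real.exp (-(b * H X))) / (∫ X in BoseGas.cellN n L, Real.exp (-(b * H X)))) ≤ C := by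
  intro hE v _hv
  obtain ⟨C₂, hC₂, hbound⟩ := exists_periodicRieszKernel_zero_le (s := 2) two_pos
  have hK : 0 < rieszSubordinationConst 2 := rieszSubordinationConst_pos two_pos
  refine ⟨1, one_pos, fun ρ hρ _hρ₁ ℓ _hℓ => ⟨C₂ / rieszSubordinationConst 2, ?_⟩⟩
  filter_upwards [eventually_ge_atTop 1] with n hn1
  intro L hL a ha b hb η hη H hH
  -- the dictionary at this `n`
  have ha0 : 0 ≤ a := ha ▸ ENNReal.toReal_nonneg
  have hb0 : 0 ≤ b := by rw [hb]; positivity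
  have hη0 : 0 < η := BoseCornerStructureFactor.eta_pos hρ hη
  have hρη3 : 1 ≤ ρ * η ^ 3 := BoseCornerStructureFactor.one_le_mul_pow_three hρ hη
  have hL0 : 0 < L := hL ▸ sideLength_pos_of_pos hρ (Nat.succ_pos n)
  have hL3 : L ^ 3 = ((n : ℝ) + 1) / ρ := by
    rw [hL, sideLength_pow_three hρ, Nat.cast_add_one]
  have hn1' : (1 : ℝ) ≤ n := by exact_mod_cast hn1
  -- the time `t₀ = ℓ² + 4η²`: `η² < t₀` and `√t₀ - η ≥ η`
  have ht₀ : η ^ 2 < ℓ ^ 2 + 4 * η ^ 2 := by nlinarith [sq_nonneg ℓ, pow_pos hη0 2]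
  have hsqrt : 2 * η ≤ Real.sqrt (ℓ ^ 2 + 4 * η ^ 2) :=
    Real.le_sqrt_of_sq_le (by nlinarith [sq_nonneg ℓ])
  have hden : η ≤ Real.sqrt (ℓ ^ 2 + 4 * η ^ 2) - η := by linarith
  have hden0 : 0 < Real.sqrt (ℓ ^ 2 + 4 * η ^ 2) - η := hη0.trans_le hden
  -- the engine at `t₀`
  have hE' := hE n L b η (ℓ ^ 2 + 4 * η ^ 2) hL0 hb0 hη0 ht₀ H hH
  set g0 : ℝ := periodicRieszKernel 2 L η 0 with hg0_def
  set K : ℝ := rieszSubordinationConst 2 with hK_def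
  set Z : ℝ := ∫ X in BoseGas.cellN n L, Real.exp (-(b * H X)) with hZ_def
  set D : ℝ := ∫ X in BoseGas.cellN n L, (∑ i : Fin n, ∑ j : Fin n,
    periodicHeatSum L (ℓ ^ 2 + 4 * η ^ 2) (X i - X j)) * Real.exp (-(b * H X)) with hD_def
  have hg0 : 0 ≤ g0 := (hbound L η hL0 hη0).1
  have hg0le : g0 ≤ C₂ * (η ^ 2)⁻¹ := by
    have h := (hbound L η hL0 hη0).2
    rwa [Real.rpow_neg hη0.le, Real.rpow_two] at h
  have hZ0 : 0 ≤ Z := setIntegral_nonneg (measurableSet_cellN n L) fun X _ => (Real.exp_pos _).le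
  have hcoef0 : 0 ≤ (n : ℝ) * g0 / (2 * K * (Real.sqrt (ℓ ^ 2 + 4 * η ^ 2) - η)) := by positivity
  -- quotient ≤ coefficient (a vanishing denominator makes the quotient `0`)
  have hquot : D / Z ≤ (n : ℝ) * g0 / (2 * K * (Real.sqrt (ℓ ^ 2 + 4 * η ^ 2) - η)) :=
    div_le_of_le_mul₀ hZ0 hcoef0 hE'
  calc L ^ 3 / (n : ℝ) ^ 2 * (D / Z)
      ≤ L ^ 3 / (n : ℝ) ^ 2 * ((n : ℝ) * g0 / (2 * K * (Real.sqrt (ℓ ^ 2 + 4 * η ^ 2) - η))) :=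
        mul_le_mul_of_nonneg_left hquot (by positivity)
    _ ≤ L ^ 3 / (n : ℝ) ^ 2 * ((n : ℝ) * g0 / (2 * K * η)) :=
        mul_le_mul_of_nonneg_left (div_le_div_of_nonneg_left (by positivity) (by positivity)
          (mul_le_mul_of_nonneg_left hden (by positivity))) (by positivity)
    _ = ((n : ℝ) + 1) / ρ / (n : ℝ) ^ 2 * ((n : ℝ) * g0 / (2 * K * η)) := by rw [hL3]
    _ ≤ C₂ / K :=
        BoseCornerStructureFactor.corner_arith hn1' hK hC₂ hρ hη0 hρη3 hg0le

end Summit.AtomisticToContinuum.BoseEinsteinCondensation.Theorems.CoarseGrainedReverseHolder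

end
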